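/-
Copyright (c) 2026. All rights reserved.
Released under Apache 2.0 license as described in the file LICENSE.
Authors: abc-iut cell, prover seat abc-iut-w5-d053 (gen 5; row «OPENAUG-SUBMODEL», file 2), over abc-iut-w4-d095's
re-pointed Prop 5.8 (vii) setting and this seat's open-augmentation sub-model (see the imports).
-/
import Literature.AnabelianGeometry.AbsoluteAnabelian.AbsTopIII.MLFGaloisModelOpenAug
import Literature.AnabelianGeometry.AbsoluteAnabelian.LogFrobeniusMonoGenuineProp58viiPf
import HarnessLib

/-!
# [AbsTopIII] Prop 5.8 (vii) / Cor 5.10 (iv): the genuine mono-analytic §5 setting with perfection vertices, RESTRICTED to the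
# open-augmentation sub-model `𝒳^{open}` (row «OPENAUG-SUBMODEL», E-L4-16)

S. Mochizuki, *Topics in absolute anabelian geometry III*, J. Math. Sci. Univ. Tokyo 22 (2015) [MochizukiAbsTopIII2015];
locators = pages of the kurims manuscript (`paper:url-5493eb38cbb7`): Def 3.1 (i) p. 66, Def 5.4 (iv) p. 127, Def 5.6 (iii)
p. 136, Prop 5.8 (vii) pp. 141–142, Cor 5.10 (iv) p. 147.

`LogFrobeniusSetting.nonarchGenuineMonoAnPfOpen p Vmod isArc` := this seat's generic sub-model setting
`nonarchGenuineMonoAnSub p P ψ` (`AbsTopIII/MLFGaloisModelOpenAug.lean`) at `P := TFModel.IsOpenAug` (objects of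
abc-iut-L4-t9's MLF model whose augmentation `ε_k : Π_k ↠ G_k` is OPEN — print's profinite case) and `ψ := MLFClosure.ψMonoPf`
(abc-iut-w4-d095's containers reading abc-iut-f-101's GENUINE perfection vertices): i.e. abc-iut-w4-d095's
`nonarchGenuineMonoAnPf p Vmod isArc` with its holomorphic rows `𝒳 = ℰ• = An•`, `𝒩⊞_v = 𝒩_v`, `λ⊞`, `ι⊞`, `Th• → Th⊢` cut down
along the inclusion `TFModelOpen.ι`, and its mono-analytic rows (`ℰ⊢`, `𝒩⊢⊞_w`, `𝒩⊢_w`, `An⊢`, `κ_{An⊢}`, `ψ^{An⊢⊞}`) UNCHANGED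
(`nonarchGenuineMonoAnPfOpen_mono_eq`, by `rfl`).  Same structural lemmas as abc-iut-w4-d095's file: `ψ` over `ℰ⊢` on the
nose, rows 4 → 5 / 6 → 7 on the nose, the mono-analyticization homotopies, Cor 5.10 (iv)(a), abc-iut-L4-t3's `IotaAnMono`
add-on inhabited with the genuine perfection arrows `ιMonoPf`; plus: EVERY object of its `𝒳` has open augmentation
(`nonarchGenuineMonoAnPfOpen_isOpenMap_aug`) — the input under which abc-iut-f-101's `η⊢`-components
(`LogFrobeniusMonoEtaComponents.lean`) exist, so that the Cor 5.10 (iv)(b)(c) PINNED row can be carried positively (row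
«MTC-GENUINE-POSITIVE-OPENAUG», abc-iut-f-101; contrast «MTC-EMPTY-AT-MONOAN» at the unrestricted model).

HONEST FRAMING / LIMITS: MODEL-LEVEL, exactly as the two parent files (one nonarchimedean place type; archimedean `w` carries
stand-in rows; `ℰ• := 𝒳`, `An• := 𝒳`; global theaters = campaign L); refereed pre-IUT material; nothing here bears on
[IUTchIII] Cor. 3.12; no side taken; typed ≠ proved elsewhere.
-/

set_option autoImplicit false

noncomputable section

open CategoryTheory

namespace Literature.AnabelianGeometry.AbsoluteAnabelian

open AbsTopIII

namespace LogFrobeniusSetting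

variable (p : ℕ) [Fact p.Prime]

/-- **abc-iut-w4-d095's re-pointed genuine mono-analytic §5 setting RESTRICTED to the open-augmentation sub-model**:
`nonarchGenuineMonoAnSub p TFModel.IsOpenAug MLFClosure.ψMonoPf`. [cite: MochizukiAbsTopIII2015, Prop 5.8 (vii) p.141] -/
def nonarchGenuineMonoAnPfOpen (Vmod : Type 1) (isArc : Vmod → Bool) : LogFrobeniusSetting Vmod isArc :=
  nonarchGenuineMonoAnSub p (TFModel.IsOpenAug (p := p)) MLFClosure.ψMonoPf Vmod isArc

variable (Vmod : Type 1) (isArc : Vmod → Bool)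

/-- `𝒳` of the restricted setting is the (lifted) open-augmentation sub-model `𝒳^{open}`.
[cite: MochizukiAbsTopIII2015, Definition 5.4 (iv) p.127] -/
theorem nonarchGenuineMonoAnPfOpen_X : (nonarchGenuineMonoAnPfOpen p Vmod isArc).X = Up (TFModelOpen p) := rfl

/-- **Every object of `𝒳` of the restricted setting has OPEN augmentation** (the defining property of the sub-model).
[cite: MochizukiAbsTopIII2015, Definition 3.1 (i) p.66] -/
theorem nonarchGenuineMonoAnPfOpen_isOpenMap_aug (A : (nonarchGenuineMonoAnPfOpen p Vmod isArc).X) :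
    IsOpenMap A.down.obj.D.aug :=
  A.down.property

/-- **The mono-analytic rows are abc-iut-w4-d095's, ON THE NOSE**: `ℰ⊢`, `𝒩⊢⊞_w`, `𝒩⊢_w`, `𝒩⊢⊞_w → 𝒩⊢_w → ℰ⊢`, `An⊢`,
`κ_{An⊢}`, `ψ^{An⊢⊞}_{w,ν}` of the restricted setting are LITERALLY those of `nonarchGenuineMonoAnPf p Vmod isArc` (so
`η⊢`-components and `ι^{An⊢⊞}` data written for either setting live in the same categories).
[cite: MochizukiAbsTopIII2015, Prop 5.8 (vii) p.141] -/
theorem nonarchGenuineMonoAnPfOpen_mono_eq :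
    (nonarchGenuineMonoAnPfOpen p Vmod isArc).Emono = (nonarchGenuineMonoAnPf p Vmod isArc).Emono ∧
      (nonarchGenuineMonoAnPfOpen p Vmod isArc).NmonoPlus = (nonarchGenuineMonoAnPf p Vmod isArc).NmonoPlus ∧
      (nonarchGenuineMonoAnPfOpen p Vmod isArc).Nmono = (nonarchGenuineMonoAnPf p Vmod isArc).Nmono ∧
      (nonarchGenuineMonoAnPfOpen p Vmod isArc).AnMono = (nonarchGenuineMonoAnPf p Vmod isArc).AnMono ∧
      (nonarchGenuineMonoAnPfOpen p Vmod isArc).forgetMono = (nonarchGenuineMonoAnPf p Vmod isArc).forgetMono ∧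
      (nonarchGenuineMonoAnPfOpen p Vmod isArc).toEmono = (nonarchGenuineMonoAnPf p Vmod isArc).toEmono ∧
      (nonarchGenuineMonoAnPfOpen p Vmod isArc).κAnMono = (nonarchGenuineMonoAnPf p Vmod isArc).κAnMono ∧
      (nonarchGenuineMonoAnPfOpen p Vmod isArc).ψAnMono = (nonarchGenuineMonoAnPf p Vmod isArc).ψAnMono :=
  ⟨rfl, rfl, rfl, rfl, rfl, rfl, rfl, rfl⟩

/-- `ψ^{An⊢⊞}_{w,ν}` of the restricted setting IS `ψMonoPf`. [cite: MochizukiAbsTopIII2015, Prop 5.8 (vii) p.141] -/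
theorem nonarchGenuineMonoAnPfOpen_ψAnMono (w : Vmod) (ν : {ν : LogVertex (isArc w) // ν.IsCross}) :
    (nonarchGenuineMonoAnPfOpen p Vmod isArc).ψAnMono w ν = Up.liftF (MLFClosure.ψMonoPf (isArc w) ν.1) := rfl

/-- `ψ^{An⊢⊞}_{w,ν}` lies over `ℰ⊢` ON THE NOSE. [cite: MochizukiAbsTopIII2015, Definition 5.6 (iii) p.136] -/
theorem nonarchGenuineMonoAnPfOpen_ψOver (w : Vmod) (ν : {ν : LogVertex (isArc w) // ν.IsCross}) :
    (nonarchGenuineMonoAnPfOpen p Vmod isArc).ψAnMono w ν ⋙ (nonarchGenuineMonoAnPfOpen p Vmod isArc).forgetMono w ⋙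
        (nonarchGenuineMonoAnPfOpen p Vmod isArc).toEmono w =
      (nonarchGenuineMonoAnPfOpen p Vmod isArc).κAnMono.inverse :=
  nonarchGenuineMonoAnSub_ψOver p _ _ Vmod isArc MLFClosure.ψMonoPf_fst w ν

/-- rows 4 → 5 (`hN`) ON THE NOSE: `(A, (Π ↷ M)) ↦ (k_A, ℚ̄_p)` both ways round. [cite: MochizukiAbsTopIII2015, Cor 5.10 p. 146] -/
theorem nonarchGenuineMonoAnPfOpen_monoN_toEmono_eq (v : Vmod) :
    (nonarchGenuineMonoAnPfOpen p Vmod isArc).monoN v ⋙ (nonarchGenuineMonoAnPfOpen p Vmod isArc).toEmono v =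
      (nonarchGenuineMonoAnPfOpen p Vmod isArc).toE v ⋙ (nonarchGenuineMonoAnPfOpen p Vmod isArc).monoAn := rfl

/-- rows 6 → 7 (`hκ`) ON THE NOSE. [cite: MochizukiAbsTopIII2015, Cor 5.10 p. 146] -/
theorem nonarchGenuineMonoAnPfOpen_κAn₂_monoAn_eq :
    (nonarchGenuineMonoAnPfOpen p Vmod isArc).κAn₂.functor ⋙ (nonarchGenuineMonoAnPfOpen p Vmod isArc).monoAn =
      (nonarchGenuineMonoAnPfOpen p Vmod isArc).κAn.inverse ⋙ (nonarchGenuineMonoAnPfOpen p Vmod isArc).monoAn := rfl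

/-- abc-iut-L4-t3's `MonoAnalyticizationHomotopies` INHABITED at the restricted setting. [cite: MochizukiAbsTopIII2015, Cor 5.10 p. 146] -/
def nonarchGenuineMonoAnPfOpen_monoAnalyticizationHomotopies :
    (nonarchGenuineMonoAnPfOpen p Vmod isArc).MonoAnalyticizationHomotopies :=
  nonarchGenuineMonoAnSub_monoAnalyticizationHomotopies p _ _ Vmod isArc

/-- **[AbsTopIII] Cor 5.10 (iv)(a) HOLDS at the restricted setting**, for `V(F_mod) ≠ ∅`.
[cite: MochizukiAbsTopIII2015, Cor 5.10 (iv)(a) p.147] -/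
theorem nonarchGenuineMonoAnPfOpen_cor510MonoCores [Nonempty Vmod] :
    (nonarchGenuineMonoAnPfOpen p Vmod isArc).Cor510MonoCores :=
  nonarchGenuineMonoAnSub_cor510MonoCores p _ _ Vmod isArc

/-- `ψ` over `ℰ⊢` on the nose ⇒ the identity isomorphisms are a legitimate `hψ` for abc-iut-L4-t3's `IotaAnMono` add-on.
[cite: MochizukiAbsTopIII2015, Definition 5.6 (iii) p. 136] -/
def nonarchGenuineMonoAnPfOpen_ψOverIso (w : Vmod) (j : {ν : LogVertex (isArc w) // ν.IsCross}) :
    (nonarchGenuineMonoAnPfOpen p Vmod isArc).ψAnMono w j ⋙ (nonarchGenuineMonoAnPfOpen p Vmod isArc).forgetMono w ⋙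
        (nonarchGenuineMonoAnPfOpen p Vmod isArc).toEmono w ≅
      (nonarchGenuineMonoAnPfOpen p Vmod isArc).κAnMono.inverse :=
  eqToIso (nonarchGenuineMonoAnPfOpen_ψOver p Vmod isArc w j)

/-- ★ **abc-iut-L4-t3's add-on `IotaAnMono` INHABITED at the restricted setting with abc-iut-f-101's GENUINE perfection arrows**
(abc-iut-w4-d095's `ιMonoPf`, same data as at `nonarchGenuineMonoAnPf` — the mono side is unchanged).
[cite: MochizukiAbsTopIII2015, Prop 5.8 (vii) p. 142] -/
def nonarchGenuineMonoAnPfOpen_iotaAnMono :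
    (nonarchGenuineMonoAnPfOpen p Vmod isArc).IotaAnMono (nonarchGenuineMonoAnPfOpen_ψOverIso p Vmod isArc) where
  ι w _ _ ε hε := Up.liftT (MLFClosure.ιMonoPf (isArc w) ε hε)
  ι_over w ν₁ ν₂ ε hε X := by
    apply InducedCategory.hom_ext
    simp only [nonarchGenuineMonoAnPfOpen_ψOverIso, eqToIso.hom, eqToIso.inv, eqToHom_app, eqToHom_trans]
    rfl

/-- `𝒳^{open}` is inhabited, hence so is `𝒳` of the restricted setting (by `(G_{ℚ_p}, id)`).
[cite: MochizukiAbsTopIII2015, Definition 3.1 (ii) p.67] -/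
theorem nonarchGenuineMonoAnPfOpen_nonempty_X : Nonempty (nonarchGenuineMonoAnPfOpen p Vmod isArc).X :=
  ⟨ULift.up (TFModelOpen.monoAnalytic p ⊥)⟩

include p in
/-- **Prop 5.8 (vii) at the genuine model with perfection vertices ON THE OPEN-AUGMENTATION SUB-MODEL, summary**: a §5 setting
whose `𝒳` is `𝒳^{open}` (every `ε_k` open, inhabited), with `ℰ⊢` the genuine groupoid of absolute Galois groups, `An⊢` print's
decorated category, `ψ^{An⊢⊞}` over `ℰ⊢` on the nose, abc-iut-L4-t3's `ι^{An⊢⊞}` add-on inhabited, and Cor 5.10 (iv)(a) for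
`V(F_mod) ≠ ∅`. [cite: MochizukiAbsTopIII2015, Prop 5.8 (vii) p.141] -/
theorem exists_genuine_prop58vii_pfOpen :
    ∃ (L : LogFrobeniusSetting Vmod isArc)
      (hψ : ∀ (w : Vmod) (j : {ν : LogVertex (isArc w) // ν.IsCross}),
        L.ψAnMono w j ⋙ L.forgetMono w ⋙ L.toEmono w ≅ L.κAnMono.inverse),
      L.X = Up (TFModelOpen p) ∧ Nonempty L.X ∧ L.Emono = Up MLFClosure.MonoBase ∧ L.AnMono = Up MLFClosure.AnMono ∧
      Nonempty (L.IotaAnMono hψ) ∧ (Nonempty Vmod → L.Cor510MonoCores) :=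
  ⟨nonarchGenuineMonoAnPfOpen p Vmod isArc, nonarchGenuineMonoAnPfOpen_ψOverIso p Vmod isArc, rfl,
    nonarchGenuineMonoAnPfOpen_nonempty_X p Vmod isArc, rfl, rfl,
    ⟨nonarchGenuineMonoAnPfOpen_iotaAnMono p Vmod isArc⟩,
    fun h => haveI := h; nonarchGenuineMonoAnPfOpen_cor510MonoCores p Vmod isArc⟩

end LogFrobeniusSetting

end Literature.AnabelianGeometry.AbsoluteAnabelian

end
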